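import Summits.NavierStokesRegularity.NavierStokesRegularity.Theorems.StrainDoorsDirectionDoorK5Floor
import Summits.NavierStokesRegularity.NavierStokesRegularity.Theorems.ScenarioCensusRowF1EpsilonLiouville
import HarnessLib

/-!
# Strain doors, PART M §M22 — DOOR K5′ CLOSED: the fixed-`δ` direction-coherence Liouville theorem

ROUND 66 of the `ns-regularity-ideate` p1 line (helper lane of `stmt-NavierStokesRegularity-0056`, rung N0;
nothing here is a claim about Navier–Stokes regularity).  Composition file (no analysis of its own):
input (P1) `SmallVorticityNumberLiouville` of door K5′ is the tree theorem
`ScenarioCensus.EpsilonTop.liouville_qw_holds : Liouville_qw` (census row F1, ε-tops; a second tree proof is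
`BlobRiccatiClosure.TypeIApexLiouville.stub_smallScaledVorticityLiouville`, route `IsobarTomography`), input
(P2) is `typeIAncientCompactness_holds` (§M21(c)), and `k5FloorReduction_holds` (§M21(b)) turns them into
★★★★ `peakDirectionSpreadFloor_holds` — DOOR K5′ — and ★★★★ `exists_pos_relDirectionCoherence_liouville`:
for every `C₀`, `R > 0`, `0 < μ < 1` a FIXED `δ(C₀,R,μ) > 0` such that a classical Type-I (`HasTypeIDecay C₀`)
ancient solution which is `δ`-direction-coherent on its `μ`-high set at parabolic range `R`, at all times,
is zero.  (Giga–Miura's (CA′) / Barker–Prange's Thm 3 assume a continuous-alignment MODULUS; here none.)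

References: Giga–Miura, Comm. Math. Phys. 303 (2011) Thm 1.1, Prop. 2.2; Barker–Prange, arXiv:1906.08225
Thm 3; Koch–Nadirashvili–Seregin–Šverák, Acta Math. 203 (2009) Lemma 6.1, Prop. 4.1.
-/

noncomputable section

open MeasureTheory Set Function Filter Metric Real InnerProductSpace
open _root_.Topology
open scoped ENNReal NNReal RealInnerProductSpace ContDiff
open Literature.Analysis Literature.Analysis.FluidPDE
open Literature.Analysis.FluidPDE.VorticityDirectionDynamics

-- the summit and its single sub-problem share the name (CONVENTIONS §1); option added at landing (ns-s30-p1 g6):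
-- the text omits it and the gate bounces Lean warnings (`lint.warning`)
set_option linter.dupNamespace false

namespace Summit.NavierStokesRegularity.NavierStokesRegularity.Theorems.StrainDoors

/-! ### §M22(a) Input (P1) is a theorem of the tree: the small-scaled-vorticity Liouville theorem -/

/-- ★★ **(P1) PROVED (by citation) — the small-vorticity-number Liouville theorem**
(`SmallVorticityNumberLiouville` of ROUND 65): for every `C` there is `η(C) > 0` such that a member of
`A_C` with vorticity number `≤ η` vanishes.  This is, up to `0 − s = −s`, the tree theorem
`ScenarioCensus.EpsilonTop.liouville_qw_holds : Liouville_qw` (scenario census row F1, the ε-form of the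
sub-Type-I-vorticity top: compactness of `𝒦_M = A_M` upgrades the exact Liouville theorem
`curl W ≡ 0 ⇒ W ≡ 0` to an `ε(M)`-Liouville theorem).  A second, independent tree proof is
`BlobRiccatiClosure.TypeIApexLiouville.stub_smallScaledVorticityLiouville` (route `IsobarTomography`, line
`type-i-apex-liouville`: local div–curl tomography of `∇W` + the KNSS gauge bounds + the small-strain rung
of route `ClockStretchingLaw`); it is not imported here only because its module closure had no farm build at
certification time.
[cite: KochNadirashviliSereginSverak2009, Lemma 6.1, Thm 5.1 (arXiv:0709.3599); MajdaBertozziCUP2002, §4.1.3 (4.39)] -/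
theorem smallVorticityNumberLiouville_holds : SmallVorticityNumberLiouville := by
  intro C
  obtain ⟨ε, hε, h⟩ := ScenarioCensus.EpsilonTop.liouville_qw_holds C
  refine ⟨ε, hε, fun u hu hsmall t ht x => h u hu (fun s hs y => ?_) t ht x⟩
  have h1 := hsmall s hs y
  rwa [zero_sub] at h1

/-! ### §M22(b) DOOR K5′ CLOSED and the fixed-`δ` direction-coherence Liouville theorem -/

/-- ★★★★ **DOOR K5′ IS A THEOREM**: for every Type-I constant `C₀`, every radius `R > 0` and every
fraction `0 < μ < 1` there is `δ = δ(C₀,R,μ) > 0` such that EVERY Type-I tangent peak `(v, z̄)` of class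
`C₀` carries two points `y, y'`, both above the `μ`-fraction of the peak height `ρ̄ = |curl v(−1)|(z̄)`,
with `|y' − y| ≤ R` and vorticity directions MORE THAN `δ` apart (`PeakDirectionSpreadFloor C₀ R μ`).
Composition of `k5FloorReduction_holds` with `smallVorticityNumberLiouville_holds` (P1) and
`typeIAncientCompactness_holds` (P2). [cite: GigaMiura2011, Prop. 2.2 and §3 (HUPS #956 pp. 6–7); KochNadirashviliSereginSverak2009, Lemma 6.1 (arXiv:0709.3599 p. 11)] -/
theorem peakDirectionSpreadFloor_holds (C₀ : ℝ) {R μ : ℝ} (hR : 0 < R) (hμ0 : 0 < μ) (hμ1 : μ < 1) :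
    PeakDirectionSpreadFloor C₀ R μ :=
  k5FloorReduction_holds smallVorticityNumberLiouville_holds typeIAncientCompactness_holds C₀ R μ hR hμ0 hμ1

/-- ★★★★ **THE FIXED-`δ` DIRECTION-COHERENCE LIOUVILLE THEOREM** (unconditional): for every `C₀`,
`R > 0`, `0 < μ < 1` there is `δ = δ(C₀,R,μ) > 0` such that every classical solution `(u, p)` of
Navier–Stokes (`ν = 1`, `f = 0`) on `(−∞,0) × ℝ³` with the Type-I envelope `HasTypeIDecay C₀ u` whose
vorticity directions differ by AT MOST `δ` between any two points above the `μ`-fraction of (a bound `W`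
for) its vorticity number `sup (0−t)|ω|` at parabolic distance `≤ R √(0−t)`, at every time
(`RelParabolicDirectionCoherence δ R μ u`), is identically zero.  Compare Giga–Miura's (CA′) and
Barker–Prange's Theorem 3, which ask for a continuous-alignment MODULUS `η(r) → 0`; here `δ` is a fixed
positive number and no modulus is assumed. [cite: GigaMiura2011, Thm 1.1 with (CA′) (HUPS #956 p. 2); BarkerPrange2020Alignment, Thm. 3 (arXiv:1906.08225 §5.2)] -/
theorem exists_pos_relDirectionCoherence_liouville (C₀ : ℝ) {R μ : ℝ} (hR : 0 < R) (hμ0 : 0 < μ)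
    (hμ1 : μ < 1) :
    ∃ δ : ℝ, 0 < δ ∧
      ∀ (u : ℝ → EuclideanSpace ℝ (Fin 3) → EuclideanSpace ℝ (Fin 3)) (p : ℝ → EuclideanSpace ℝ (Fin 3) → ℝ),
        IsClassicalNSSolutionOn (Iio 0) 1 0 u p → HasTypeIDecay C₀ u → RelParabolicDirectionCoherence δ R μ u →
        ∀ t : ℝ, t < 0 → ∀ x : EuclideanSpace ℝ (Fin 3), u t x = 0 :=
  exists_pos_coherence_liouville_of_floor hμ0.le (peakDirectionSpreadFloor_holds C₀ hR hμ0 hμ1)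

end Summit.NavierStokesRegularity.NavierStokesRegularity.Theorems.StrainDoors

end
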